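import Mathlib
import Literature.Computability.Complexity.RandomKSatEnsembleOGP

/-!
# Route OverlapGapAlgebra, crux `SearchHardWindow` (stmt-PneNP-2460), line `Sketch`: the chaos lemma
# (Huang–Sellke 2025, Lemma 3.23) assembled from the per-tuple first moment

Stub `stub_chaosAssembly` of the skeleton `Summits/PneNP/PneNP/Cruxes/SearchHardWindow/Lines/Sketch.lean`
(section `Chaos`). Vocabulary (`resampleChainMass`, `overlapCondEnt`) is the tree's
`Literature/Computability/Complexity/RandomKSatEnsembleOGP.lean`; the conclusion is VERBATIM the
CHAOS clause of the named fact `HuangSellke2025KSatObstructions` there, for every `k ≥ 2` and every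
`β < 5 log k / k`.

The four generic inputs are hypotheses (discharged by name in the skeleton, so that this file waits
for no build): `hMono` (monotonicity of the chain mass, `stub_chainMassBasic`.1), `hUnion` (finite
union bound, `stub_chainMassUnion`), `hTuple` (the first moment for ONE time tuple,
`stub_chaosTupleBound`: mass `≤ (1 − (E_Δ/2)^k)^m (n+1)^{2^j} e^{nβ}`, `E_Δ = 1 − (1−ε)^Δ`) and `hAsy`
(the real-analysis bookkeeping `stub_chaosAsymptotics`:
`(k+1)(K+1)^{k+1} (n+1)^{2^k} e^{nβ} (1 − (E/2)^k)^{⌊α_k n⌋} ≤ e^{−cn}` eventually, for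
`E ≥ E_b = 1 − e^{−1/(bk)}`).

The proof (Huang–Sellke 2025, arXiv:2501.06427 §3.3.2, proof of Lemma 3.23; Bresler–Huang 2021 §4.6):
at one large `n` (where `D n < n`, so `0 < ε = log(n / D n)/n ≤ 1`),
* reindex the CHAOS event by the finitely many pairs (`j' : Fin k`, time tuple
  `τ' : Fin (k+1) → Fin (K+1)`), `j = j' + 1`, `τ ℓ = τ' (ℓ mod (k+1))` (`cas_incl`), so that
  `mass(CHAOS) ≤ Σ_{j', τ'} mass(C_{j,τ})` (`hMono`, `hUnion` twice);
* bound each reindexed event (`cas_pair_bound`): if its deterministic side conditions (monotone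
  times, gap `τ j ≥ τ (j−1) + 1/(bkε)`) fail it is empty (mass `0`, `cas_mass_false`); otherwise
  `hTuple` with `s = τ (j−1)`, `Δ = τ j − s` applies, and `εΔ ≥ 1/(bk)` gives
  `(1−ε)^Δ ≤ e^{−εΔ} ≤ e^{−1/(bk)}` (`cas_pow_le_exp`), i.e. `E_b ≤ E_Δ`, whence
  `(1 − (E_Δ/2)^k)^m ≤ (1 − (E_b/2)^k)^m` (`cas_antitone`) and `(n+1)^{2^j} ≤ (n+1)^{2^k}`;
* sum: `k (K+1)^{k+1}` pairs (`cas_core`), `≤ (k+1)(K+1)^{k+1} · Q ≤ e^{−cn}` by `hAsy` at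
  `E = E_b`.

References: B. Huang, M. Sellke, *Strong low degree hardness for stable local optima in spin
glasses*, arXiv:2501.06427 (2025), §3.3.2, Lemma 3.23 [HuangSellke2025]; G. Bresler, B. Huang,
FOCS 2021 / arXiv:2106.02129, §4.6 [BreslerHuang2022].
-/

set_option linter.dupNamespace false -- `Summit.PneNP.PneNP.…`: summit = sub-problem

namespace Summit.PneNP.PneNP.Theorems

open Finset Filter Asymptotics Topology
open Literature.Computability.Complexity
open scoped Classical

/-! ## Small real-analysis helpers -/

/-- Eventually `D n < n` for `D = o(n)`. -/
theorem cas_eventually_lt (D : ℕ → ℕ)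
    (hD : (fun n : ℕ => (D n : ℝ)) =o[atTop] (fun n : ℕ => (n : ℝ))) :
    ∀ᶠ n : ℕ in atTop, (D n : ℝ) < n := by
  have hx : Tendsto (fun n : ℕ => (D n : ℝ) / n) atTop (𝓝 0) := hD.tendsto_div_nhds_zero
  filter_upwards [(tendsto_order.1 hx).2 1 one_pos, eventually_gt_atTop 0] with n h1 hn0
  exact (div_lt_one (Nat.cast_pos.2 hn0)).1 h1

/-- The resampling rate `ε = log(n / D)/n` lies in `(0, 1]` once `1 ≤ D < n`
(`log y > 0` for `y > 1`, and `log y ≤ y - 1 < y ≤ n` for `y = n / D`). -/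
theorem cas_eps_bounds (n D : ℕ) (hDn : (D : ℝ) < n) (hD : 1 ≤ D) :
    0 < Real.log (n / D) / n ∧ Real.log (n / D) / n ≤ 1 := by
  have hD' : (1 : ℝ) ≤ D := by exact_mod_cast hD
  have hD0 : (0 : ℝ) < D := by linarith
  have hn' : (0 : ℝ) < n := hD0.trans hDn
  refine ⟨div_pos (Real.log_pos ((one_lt_div hD0).2 hDn)) hn', ?_⟩
  have h1 : (n : ℝ) / D ≤ n := div_le_self hn'.le hD'
  have h2 : Real.log (n / D) ≤ (n : ℝ) / D - 1 := Real.log_le_sub_one_of_pos (div_pos hn' hD0)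
  rw [div_le_one hn']
  linarith

/-- `(1 − ε)^Δ ≤ e^{−r}` whenever `0 ≤ ε ≤ 1` and `r ≤ ε Δ` (`1 − ε ≤ e^{−ε}`). -/
theorem cas_pow_le_exp (ε r : ℝ) (hε0 : 0 ≤ ε) (hε1 : ε ≤ 1) (Δ : ℕ) (h : r ≤ ε * Δ) :
    (1 - ε) ^ Δ ≤ Real.exp (-r) := by
  have h1 : (1 - ε) ^ Δ ≤ Real.exp (-ε) ^ Δ :=
    pow_le_pow_left₀ (by linarith) (by linarith [Real.add_one_le_exp (-ε)]) Δ
  refine h1.trans ?_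
  rw [← Real.exp_nat_mul, Real.exp_le_exp]
  have := hε0
  nlinarith

/-- `0 ≤ 1 − (E/2)^k` for `E ∈ [0, 1]`. -/
theorem cas_base_nonneg (E : ℝ) (k : ℕ) (hE0 : 0 ≤ E) (hE1 : E ≤ 1) : 0 ≤ 1 - (E / 2) ^ k := by
  have : (E / 2) ^ k ≤ 1 := pow_le_one₀ (by linarith) (by linarith)
  linarith

/-- `E ↦ (1 − (E/2)^k)^m` is antitone on `[0, 1]`. -/
theorem cas_antitone (E E' : ℝ) (k m : ℕ) (hE0 : 0 ≤ E) (hEE' : E ≤ E') (hE'1 : E' ≤ 1) :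
    (1 - (E' / 2) ^ k) ^ m ≤ (1 - (E / 2) ^ k) ^ m := by
  have h1 : (E / 2) ^ k ≤ (E' / 2) ^ k := pow_le_pow_left₀ (by linarith) (by linarith) k
  exact pow_le_pow_left₀ (cas_base_nonneg E' k (by linarith) hE'1) (by linarith) m

/-! ## Combinatorial helpers: monotone prefixes, the empty event, the event of one pair, reindexing -/

/-- A sequence that is monotone step by step below `j` is bounded by its value at `j` there. -/
theorem cas_mono_prefix (τ : ℕ → ℕ) :
    ∀ j : ℕ, (∀ ℓ < j, τ ℓ ≤ τ (ℓ + 1)) → ∀ ℓ ≤ j, τ ℓ ≤ τ j := by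
  intro j
  induction j with
  | zero =>
    intro _ ℓ hℓ
    rw [Nat.le_zero.1 hℓ]
  | succ j ih =>
    intro h ℓ hℓ
    rcases Nat.lt_or_eq_of_le hℓ with hlt | rfl
    · exact (ih (fun ℓ' hℓ' => h ℓ' (Nat.lt_succ_of_lt hℓ')) ℓ (Nat.lt_succ_iff.1 hlt)).trans
        (h j (Nat.lt_succ_self j))
    · exact le_rfl

/-- The empty event has chain mass `0`. -/
theorem cas_mass_false {ι Γ : Type*} [Fintype ι] [DecidableEq ι] [Fintype Γ] [DecidableEq Γ]
    (ε : ℝ) (K : ℕ) : resampleChainMass ε K (fun _ : ℕ → ι → Γ => False) = 0 := by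
  simp [resampleChainMass]

/-- **The chaos event of ONE pair** (`j`, time map `τ`) — the deterministic side conditions
(`τ 0 ≤ ⋯ ≤ τ j`, gap `τ j ≥ τ (j−1) + 1/(bkε)`) and an assignment `x` satisfying the instance at
time `τ j` with conditional overlap entropy `≤ β` given the outputs `a` at the earlier times — holds
along `τ` as soon as its data are given along a time map `t` agreeing with `τ` on `ℓ ≤ j`. -/
theorem cas_event_intro (n m k : ℕ) (b ε β : ℝ)
    (a : (Fin m × Fin k → Fin n × Bool) → (Fin n → Bool)) (j : ℕ) (τ t : ℕ → ℕ)
    (hτt : ∀ ℓ ≤ j, τ ℓ = t ℓ) (z : ℕ → (Fin m × Fin k → Fin n × Bool)) (x : Fin n → Bool)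
    (hmono : ∀ ℓ < j, t ℓ ≤ t (ℓ + 1)) (hgap : (t (j - 1) : ℝ) + 1 / (b * k * ε) ≤ t j)
    (hsat : ∀ i : Fin m, ∃ j' : Fin k, x (z (t j) (i, j')).1 = (z (t j) (i, j')).2)
    (hent : overlapCondEnt (fun ℓ => if ℓ < j then a (z (t ℓ)) else x) j ≤ β) :
    (∀ ℓ < j, τ ℓ ≤ τ (ℓ + 1)) ∧ ((τ (j - 1) : ℝ) + 1 / (b * k * ε) ≤ τ j) ∧
      ∃ x : Fin n → Bool,
        (∀ i : Fin m, ∃ j' : Fin k, x (z (τ j) (i, j')).1 = (z (τ j) (i, j')).2) ∧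
        overlapCondEnt (fun ℓ => if ℓ < j then a (z (τ ℓ)) else x) j ≤ β := by
  have hj : τ j = t j := hτt j le_rfl
  refine ⟨fun ℓ hℓ => ?_, ?_, x, ?_, ?_⟩
  · rw [hτt ℓ hℓ.le, hτt (ℓ + 1) (Nat.succ_le_of_lt hℓ)]
    exact hmono ℓ hℓ
  · rw [hτt (j - 1) (Nat.sub_le j 1), hj]
    exact hgap
  · rw [hj]
    exact hsat
  · have hce : overlapCondEnt (fun ℓ => if ℓ < j then a (z (τ ℓ)) else x) j =
        overlapCondEnt (fun ℓ => if ℓ < j then a (z (t ℓ)) else x) j := by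
      congr 1
      funext ℓ
      by_cases hℓ : ℓ < j
      · simp only [if_pos hℓ, hτt ℓ hℓ.le]
      · simp only [if_neg hℓ]
    exact hce.trans_le hent

/-- **Reindexing**: a path carrying a CHAOS structure (`1 ≤ j ≤ k`, times `t 0 ≤ ⋯ ≤ t j ≤ K` with the
gap, a satisfying low-entropy `x`) carries the chaos event of the pair
`p = (j − 1 : Fin k, i ↦ t (min i j) : Fin (k+1) → Fin (K+1))`, read with `j = p.1 + 1` and the time
map `ℓ ↦ p.2 (ℓ mod (k+1))` (which is `t ℓ` for `ℓ ≤ j`). -/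
theorem cas_incl (n m k K : ℕ) (b ε β : ℝ)
    (a : (Fin m × Fin k → Fin n × Bool) → (Fin n → Bool))
    (z : ℕ → (Fin m × Fin k → Fin n × Bool))
    (hz : ∃ (j : ℕ) (t : ℕ → ℕ) (x : Fin n → Bool), 1 ≤ j ∧ j ≤ k ∧
        (∀ ℓ < j, t ℓ ≤ t (ℓ + 1)) ∧ t j ≤ K ∧ (t (j - 1) : ℝ) + 1 / (b * k * ε) ≤ t j ∧
        (∀ i : Fin m, ∃ j' : Fin k, x (z (t j) (i, j')).1 = (z (t j) (i, j')).2) ∧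
        overlapCondEnt (fun ℓ => if ℓ < j then a (z (t ℓ)) else x) j ≤ β) :
    ∃ p : Fin k × (Fin (k + 1) → Fin (K + 1)),
      (∀ ℓ < (p.1 : ℕ) + 1,
        (p.2 (Fin.ofNat (k + 1) ℓ) : ℕ) ≤ (p.2 (Fin.ofNat (k + 1) (ℓ + 1)) : ℕ)) ∧
      (((p.2 (Fin.ofNat (k + 1) ((p.1 : ℕ) + 1 - 1)) : ℕ) : ℝ) + 1 / (b * k * ε)
        ≤ (p.2 (Fin.ofNat (k + 1) ((p.1 : ℕ) + 1)) : ℕ)) ∧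
      ∃ x : Fin n → Bool,
        (∀ i : Fin m, ∃ j' : Fin k,
          x (z (p.2 (Fin.ofNat (k + 1) ((p.1 : ℕ) + 1)) : ℕ) (i, j')).1 =
            (z (p.2 (Fin.ofNat (k + 1) ((p.1 : ℕ) + 1)) : ℕ) (i, j')).2) ∧
        overlapCondEnt
          (fun ℓ => if ℓ < (p.1 : ℕ) + 1 then a (z (p.2 (Fin.ofNat (k + 1) ℓ) : ℕ)) else x)
          ((p.1 : ℕ) + 1) ≤ β := by
  obtain ⟨j, t, x, h1j, hjk, hmono, htK, hgap, hsat, hent⟩ := hz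
  obtain ⟨j', rfl⟩ : ∃ j' : ℕ, j = j' + 1 := ⟨j - 1, (Nat.sub_add_cancel h1j).symm⟩
  have hpre : ∀ ℓ ≤ j' + 1, t ℓ ≤ t (j' + 1) := cas_mono_prefix t (j' + 1) hmono
  have hbd : ∀ ℓ : ℕ, t (min ℓ (j' + 1)) < K + 1 := fun ℓ =>
    Nat.lt_succ_of_le ((hpre _ (Nat.min_le_right ℓ (j' + 1))).trans htK)
  refine ⟨(⟨j', hjk⟩, fun i => ⟨t (min (i : ℕ) (j' + 1)), hbd i⟩), ?_⟩
  refine cas_event_intro n m k b ε β a (j' + 1) (fun ℓ => t (min (ℓ % (k + 1)) (j' + 1))) t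
    (fun ℓ hℓ => ?_) z x hmono hgap hsat hent
  rw [Nat.mod_eq_of_lt (by omega), min_eq_left hℓ]

/-! ## The bound for one pair, and the sum over pairs -/

/-- **Mass of one reindexed event** `≤ Q = (1 − (E_b/2)^k)^m (n+1)^{2^k} e^{nβ}`,
`E_b = 1 − e^{−1/(bk)}`: empty if the side conditions fail; otherwise the per-tuple first moment
`hTuple` with `s = τ (j−1)`, `Δ = τ j − s`, and `E_b ≤ E_Δ = 1 − (1−ε)^Δ` from `εΔ ≥ 1/(bk)`. -/
theorem cas_pair_bound
    (hMono : ∀ {ι Γ : Type} [Fintype ι] [DecidableEq ι] [Fintype Γ] [DecidableEq Γ] [Nonempty Γ]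
      (ε : ℝ), 0 ≤ ε → ε ≤ 1 → ∀ (K : ℕ) (E E' : (ℕ → ι → Γ) → Prop), (∀ z, E z → E' z) →
      resampleChainMass ε K E ≤ resampleChainMass ε K E')
    (hTuple : ∀ (n m k : ℕ), 1 ≤ n → ∀ (ε : ℝ), 0 ≤ ε → ε ≤ 1 → ∀ (K j s Δ : ℕ), 1 ≤ j →
      s + Δ ≤ K → ∀ (τ : ℕ → ℕ), (∀ ℓ < j, τ ℓ ≤ s) →
      ∀ (a : (Fin m × Fin k → Fin n × Bool) → (Fin n → Bool)) (β : ℝ),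
      resampleChainMass ε K (fun z : ℕ → (Fin m × Fin k → Fin n × Bool) =>
          ∃ x : Fin n → Bool,
            (∀ i : Fin m, ∃ j' : Fin k, x (z (s + Δ) (i, j')).1 = (z (s + Δ) (i, j')).2) ∧
            overlapCondEnt (fun ℓ => if ℓ < j then a (z (τ ℓ)) else x) j ≤ β)
        ≤ (1 - ((1 - (1 - ε) ^ Δ) / 2) ^ k) ^ m * (((n : ℝ) + 1) ^ (2 ^ j) * Real.exp (n * β)))
    (n m k K : ℕ) (hn : 1 ≤ n) (hk : 1 ≤ k) (ε b β : ℝ) (hε0 : 0 < ε) (hε1 : ε ≤ 1) (hb : 0 < b)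
    (a : (Fin m × Fin k → Fin n × Bool) → (Fin n → Bool)) (j : ℕ) (hj : 1 ≤ j) (hjk : j ≤ k)
    (τ : ℕ → ℕ) (hτK : ∀ ℓ, τ ℓ ≤ K) :
    resampleChainMass ε K (fun z : ℕ → (Fin m × Fin k → Fin n × Bool) =>
        (∀ ℓ < j, τ ℓ ≤ τ (ℓ + 1)) ∧ ((τ (j - 1) : ℝ) + 1 / (b * k * ε) ≤ τ j) ∧
          ∃ x : Fin n → Bool,
            (∀ i : Fin m, ∃ j' : Fin k, x (z (τ j) (i, j')).1 = (z (τ j) (i, j')).2) ∧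
            overlapCondEnt (fun ℓ => if ℓ < j then a (z (τ ℓ)) else x) j ≤ β) ≤
      (1 - ((1 - Real.exp (-(1 / (b * k)))) / 2) ^ k) ^ m *
        (((n : ℝ) + 1) ^ (2 ^ k) * Real.exp (n * β)) := by
  haveI : Nonempty (Fin n × Bool) := ⟨(⟨0, hn⟩, true)⟩
  have hk0 : (0 : ℝ) < k := Nat.cast_pos.2 hk
  have hEb0 : 0 ≤ 1 - Real.exp (-(1 / (b * k))) := by
    have h' : Real.exp (-(1 / (b * k))) ≤ 1 :=
      Real.exp_le_one_iff.2 (neg_nonpos.2 (by positivity))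
    linarith
  have hEb1 : 1 - Real.exp (-(1 / (b * k))) ≤ 1 := by
    linarith [Real.exp_pos (-(1 / (b * k)))]
  have hX : 0 ≤ (1 - ((1 - Real.exp (-(1 / (b * k)))) / 2) ^ k) ^ m :=
    pow_nonneg (cas_base_nonneg _ k hEb0 hEb1) m
  have hQ0 : 0 ≤ (1 - ((1 - Real.exp (-(1 / (b * k)))) / 2) ^ k) ^ m *
      (((n : ℝ) + 1) ^ (2 ^ k) * Real.exp (n * β)) := mul_nonneg hX (by positivity)
  by_cases hside : (∀ ℓ < j, τ ℓ ≤ τ (ℓ + 1)) ∧ ((τ (j - 1) : ℝ) + 1 / (b * k * ε) ≤ τ j)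
  · obtain ⟨hmn, hgap⟩ := hside
    have hle : τ (j - 1) ≤ τ j := by
      have h := hmn (j - 1) (by omega)
      rwa [Nat.sub_add_cancel hj] at h
    have hsΔ : τ (j - 1) + (τ j - τ (j - 1)) = τ j := by omega
    have hsK : τ (j - 1) + (τ j - τ (j - 1)) ≤ K := by
      have h := hτK j
      omega
    have hpre : ∀ ℓ < j, τ ℓ ≤ τ (j - 1) := fun ℓ hℓ =>
      cas_mono_prefix τ (j - 1) (fun ℓ' hℓ' => hmn ℓ' (by omega)) ℓ (by omega)
    -- the per-tuple first moment with `s = τ (j-1)`, `Δ = τ j - τ (j-1)`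
    have h1 := hTuple n m k hn ε hε0.le hε1 K j (τ (j - 1)) (τ j - τ (j - 1)) hj hsK τ hpre a β
    refine le_trans (hMono ε hε0.le hε1 K _ _ fun z hz => ?_) (h1.trans ?_)
    · -- drop the side conditions; the candidate time `s + Δ` is `τ j`
      obtain ⟨-, -, x, hsat, hent⟩ := hz
      refine ⟨x, ?_, hent⟩
      rw [hsΔ]
      exact hsat
    · -- `E_b ≤ E_Δ` from the gap, and `2 ^ j ≤ 2 ^ k`
      have hΔ : 1 / (b * k) ≤ ε * ((τ j - τ (j - 1) : ℕ) : ℝ) := by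
        rw [Nat.cast_sub hle]
        have hbkε : 0 < b * k * ε := by positivity
        have hg : 1 / (b * k * ε) ≤ (τ j : ℝ) - τ (j - 1) := by linarith
        calc 1 / (b * k) = ε * (1 / (b * k * ε)) := by field_simp
          _ ≤ ε * ((τ j : ℝ) - τ (j - 1)) := by gcongr
      have hEΔ : 1 - Real.exp (-(1 / (b * k))) ≤ 1 - (1 - ε) ^ (τ j - τ (j - 1)) := by
        linarith [cas_pow_le_exp ε (1 / (b * k)) hε0.le hε1 (τ j - τ (j - 1)) hΔ]
      have hEΔ1 : 1 - (1 - ε) ^ (τ j - τ (j - 1)) ≤ 1 := by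
        linarith [pow_nonneg (sub_nonneg.2 hε1) (τ j - τ (j - 1))]
      have hA := cas_antitone _ _ k m hEb0 hEΔ hEΔ1
      have hB : ((n : ℝ) + 1) ^ (2 ^ j) * Real.exp (n * β) ≤
          ((n : ℝ) + 1) ^ (2 ^ k) * Real.exp (n * β) :=
        mul_le_mul_of_nonneg_right
          (pow_le_pow_right₀ (by linarith [(Nat.cast_nonneg n : (0 : ℝ) ≤ n)])
            (pow_le_pow_right₀ (by norm_num) hjk))
          (Real.exp_pos _).le
      exact mul_le_mul hA hB (by positivity) hX
  · -- the side conditions fail: the event is empty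
    refine le_trans (hMono ε hε0.le hε1 K _
      (fun _ : ℕ → (Fin m × Fin k → Fin n × Bool) => False) fun z hz => ?_) ?_
    · obtain ⟨h1, h2, -⟩ := hz
      exact hside ⟨h1, h2⟩
    · rw [cas_mass_false]
      exact hQ0

/-- **The chaos first moment at one instance size**: `mass(CHAOS) ≤ k (K+1)^{k+1} · Q` — reindex by
the pairs (`cas_incl`, `hMono`), union bound (`hUnion`, twice), bound each pair (`cas_pair_bound`)
and count the `k (K+1)^{k+1}` pairs. -/
theorem cas_core
    (hMono : ∀ {ι Γ : Type} [Fintype ι] [DecidableEq ι] [Fintype Γ] [DecidableEq Γ] [Nonempty Γ]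
      (ε : ℝ), 0 ≤ ε → ε ≤ 1 → ∀ (K : ℕ) (E E' : (ℕ → ι → Γ) → Prop), (∀ z, E z → E' z) →
      resampleChainMass ε K E ≤ resampleChainMass ε K E')
    (hUnion : ∀ {ι Γ X : Type} [Fintype ι] [DecidableEq ι] [Fintype Γ] [DecidableEq Γ] [Nonempty Γ]
      [Fintype X] (ε : ℝ), 0 ≤ ε → ε ≤ 1 → ∀ (K : ℕ) (E : X → (ℕ → ι → Γ) → Prop),
      resampleChainMass ε K (fun z => ∃ x, E x z) ≤ ∑ x, resampleChainMass ε K (E x))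
    (hTuple : ∀ (n m k : ℕ), 1 ≤ n → ∀ (ε : ℝ), 0 ≤ ε → ε ≤ 1 → ∀ (K j s Δ : ℕ), 1 ≤ j →
      s + Δ ≤ K → ∀ (τ : ℕ → ℕ), (∀ ℓ < j, τ ℓ ≤ s) →
      ∀ (a : (Fin m × Fin k → Fin n × Bool) → (Fin n → Bool)) (β : ℝ),
      resampleChainMass ε K (fun z : ℕ → (Fin m × Fin k → Fin n × Bool) =>
          ∃ x : Fin n → Bool,
            (∀ i : Fin m, ∃ j' : Fin k, x (z (s + Δ) (i, j')).1 = (z (s + Δ) (i, j')).2) ∧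
            overlapCondEnt (fun ℓ => if ℓ < j then a (z (τ ℓ)) else x) j ≤ β)
        ≤ (1 - ((1 - (1 - ε) ^ Δ) / 2) ^ k) ^ m * (((n : ℝ) + 1) ^ (2 ^ j) * Real.exp (n * β)))
    (n m k K : ℕ) (hn : 1 ≤ n) (hk : 1 ≤ k) (ε b β : ℝ) (hε0 : 0 < ε) (hε1 : ε ≤ 1) (hb : 0 < b)
    (a : (Fin m × Fin k → Fin n × Bool) → (Fin n → Bool)) :
    resampleChainMass ε K (fun y : ℕ → (Fin m × Fin k → Fin n × Bool) =>
        ∃ (j : ℕ) (t : ℕ → ℕ) (x : Fin n → Bool), 1 ≤ j ∧ j ≤ k ∧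
          (∀ ℓ < j, t ℓ ≤ t (ℓ + 1)) ∧ t j ≤ K ∧ (t (j - 1) : ℝ) + 1 / (b * k * ε) ≤ t j ∧
          (∀ i : Fin m, ∃ j' : Fin k, x (y (t j) (i, j')).1 = (y (t j) (i, j')).2) ∧
          overlapCondEnt (fun ℓ => if ℓ < j then a (y (t ℓ)) else x) j ≤ β)
      ≤ (k : ℝ) * ((K : ℝ) + 1) ^ (k + 1) *
        ((1 - ((1 - Real.exp (-(1 / (b * k)))) / 2) ^ k) ^ m *
          (((n : ℝ) + 1) ^ (2 ^ k) * Real.exp (n * β))) := by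
  haveI : Nonempty (Fin n × Bool) := ⟨(⟨0, hn⟩, true)⟩
  -- the bound for every pair `p = (j - 1, time tuple)`, time map `ℓ ↦ p.2 (ℓ mod (k+1))`
  have h3 := fun p : Fin k × (Fin (k + 1) → Fin (K + 1)) =>
    cas_pair_bound hMono hTuple n m k K hn hk ε b β hε0 hε1 hb a ((p.1 : ℕ) + 1)
      (Nat.le_add_left 1 _) p.1.isLt (fun ℓ => (p.2 (Fin.ofNat (k + 1) ℓ) : ℕ))
      (fun ℓ => Nat.le_of_lt_succ (p.2 (Fin.ofNat (k + 1) ℓ)).isLt)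
  -- union bound over the pairs, then the per-pair bound
  have h23 := (hUnion ε hε0.le hε1 K _).trans (Finset.sum_le_sum fun p _ => h3 p)
  -- reindexing, and the count of the pairs
  refine (hMono ε hε0.le hε1 K _ _ fun z hz => cas_incl n m k K b ε β a z hz).trans
    (h23.trans (le_of_eq ?_))
  simp only [Finset.sum_const, Finset.card_univ, Fintype.card_prod, Fintype.card_fun,
    Fintype.card_fin, nsmul_eq_mul]
  push_cast
  ring

/-! ## The stub -/

/-- **The chaos lemma (Huang–Sellke 2025, Lemma 3.23) as a THEOREM** (stub `stub_chaosAssembly` of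
line `Sketch`), for every `k ≥ 2` and `β < 5 log k / k`: with `b₁` and, for `0 < b ≤ b₁` and every
exponent `A`, the rate `c` of the asymptotics `hAsy`, eventually in `n` — `m = ⌊5·2^k log k/k · n⌋`,
`ε = log(n / D n)/n ∈ (0, 1]` (as `1 ≤ D n < n` eventually, `D = o(n)`), every chain length
`K ≤ n^A` — the CHAOS event has mass `≤ k (K+1)^{k+1} (1 − (E_b/2)^k)^m (n+1)^{2^k} e^{nβ}`
(`cas_core`: reindexing, `hMono`, `hUnion`, `hTuple`) `≤ e^{−cn}` (`hAsy` at `E = E_b`). -/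
theorem stub_chaosAssembly
    (hMono : ∀ {ι Γ : Type} [Fintype ι] [DecidableEq ι] [Fintype Γ] [DecidableEq Γ] [Nonempty Γ]
      (ε : ℝ), 0 ≤ ε → ε ≤ 1 → ∀ (K : ℕ) (E E' : (ℕ → ι → Γ) → Prop), (∀ z, E z → E' z) →
      resampleChainMass ε K E ≤ resampleChainMass ε K E')
    (hUnion : ∀ {ι Γ X : Type} [Fintype ι] [DecidableEq ι] [Fintype Γ] [DecidableEq Γ] [Nonempty Γ]
      [Fintype X] (ε : ℝ), 0 ≤ ε → ε ≤ 1 → ∀ (K : ℕ) (E : X → (ℕ → ι → Γ) → Prop),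
      resampleChainMass ε K (fun z => ∃ x, E x z) ≤ ∑ x, resampleChainMass ε K (E x))
    (hTuple : ∀ (n m k : ℕ), 1 ≤ n → ∀ (ε : ℝ), 0 ≤ ε → ε ≤ 1 → ∀ (K j s Δ : ℕ), 1 ≤ j →
      s + Δ ≤ K → ∀ (τ : ℕ → ℕ), (∀ ℓ < j, τ ℓ ≤ s) →
      ∀ (a : (Fin m × Fin k → Fin n × Bool) → (Fin n → Bool)) (β : ℝ),
      resampleChainMass ε K (fun z : ℕ → (Fin m × Fin k → Fin n × Bool) =>
          ∃ x : Fin n → Bool,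
            (∀ i : Fin m, ∃ j' : Fin k, x (z (s + Δ) (i, j')).1 = (z (s + Δ) (i, j')).2) ∧
            overlapCondEnt (fun ℓ => if ℓ < j then a (z (τ ℓ)) else x) j ≤ β)
        ≤ (1 - ((1 - (1 - ε) ^ Δ) / 2) ^ k) ^ m * (((n : ℝ) + 1) ^ (2 ^ j) * Real.exp (n * β)))
    (hAsy : ∀ (k : ℕ), 2 ≤ k → ∀ (β : ℝ), β < 5 * Real.log k / k →
      ∃ b₁ : ℝ, 0 < b₁ ∧ ∀ b : ℝ, 0 < b → b ≤ b₁ → ∀ A : ℕ, ∃ c : ℝ, 0 < c ∧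
        ∀ᶠ n : ℕ in atTop, ∀ K : ℕ, K ≤ n ^ A → ∀ E : ℝ, 1 - Real.exp (-(1 / (b * k))) ≤ E →
          E ≤ 1 →
          ((k : ℝ) + 1) * ((K : ℝ) + 1) ^ (k + 1) *
              ((((n : ℝ) + 1) ^ (2 ^ k)) * Real.exp (n * β)) *
              (1 - (E / 2) ^ k) ^ ⌊5 * 2 ^ k * Real.log k / k * n⌋₊
            ≤ Real.exp (-(c * n))) :
    ∀ k : ℕ, 2 ≤ k → ∀ β : ℝ, β < 5 * Real.log k / k →
    ∃ b₁ : ℝ, 0 < b₁ ∧ ∀ b : ℝ, 0 < b → b ≤ b₁ → ∀ D : ℕ → ℕ,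
      (fun n : ℕ => (D n : ℝ)) =o[atTop] (fun n : ℕ => (n : ℝ)) → (∀ n, 1 ≤ D n) →
      ∀ (a : (n m : ℕ) → (Fin m × Fin k → Fin n × Bool) → (Fin n → Bool)) (A : ℕ),
      ∃ c : ℝ, 0 < c ∧ ∀ᶠ n : ℕ in atTop, ∀ m : ℕ, m = ⌊5 * 2 ^ k * Real.log k / k * n⌋₊ →
        ∀ ε : ℝ, ε = Real.log (n / D n) / n → ∀ K : ℕ, K ≤ n ^ A →
        resampleChainMass ε K (fun y : ℕ → (Fin m × Fin k → Fin n × Bool) =>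
            ∃ (j : ℕ) (t : ℕ → ℕ) (x : Fin n → Bool), 1 ≤ j ∧ j ≤ k ∧
              (∀ ℓ < j, t ℓ ≤ t (ℓ + 1)) ∧ t j ≤ K ∧ (t (j - 1) : ℝ) + 1 / (b * k * ε) ≤ t j ∧
              (∀ i : Fin m, ∃ j' : Fin k, x (y (t j) (i, j')).1 = (y (t j) (i, j')).2) ∧
              overlapCondEnt (fun ℓ => if ℓ < j then a n m (y (t ℓ)) else x) j ≤ β)
          ≤ Real.exp (-(c * n)) := by
  intro k hk β hβ
  obtain ⟨b₁, hb₁, hasy⟩ := hAsy k hk β hβ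
  refine ⟨b₁, hb₁, fun b hb hbb₁ D hD hD1 a A => ?_⟩
  obtain ⟨c, hc, hev⟩ := hasy b hb hbb₁ A
  refine ⟨c, hc, ?_⟩
  filter_upwards [hev, cas_eventually_lt D hD, eventually_ge_atTop 1] with n hevn hDn hn1
  intro m hm ε hε K hK
  have hk1 : 1 ≤ k := le_trans one_le_two hk
  have hk0 : (0 : ℝ) < k := Nat.cast_pos.2 hk1
  obtain ⟨hεpos, hε1⟩ : 0 < ε ∧ ε ≤ 1 := by
    rw [hε]
    exact cas_eps_bounds n (D n) hDn (hD1 n)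
  have hEb0 : 0 ≤ 1 - Real.exp (-(1 / (b * k))) := by
    have h' : Real.exp (-(1 / (b * k))) ≤ 1 :=
      Real.exp_le_one_iff.2 (neg_nonpos.2 (by positivity))
    linarith
  have hEb1 : 1 - Real.exp (-(1 / (b * k))) ≤ 1 := by
    linarith [Real.exp_pos (-(1 / (b * k)))]
  have hfin := hevn K hK (1 - Real.exp (-(1 / (b * k)))) le_rfl hEb1
  rw [← hm] at hfin
  refine (cas_core hMono hUnion hTuple n m k K hn1 hk1 ε b β hεpos hε1 hb (a n m)).trans
    (le_trans ?_ hfin)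
  have hP : (0 : ℝ) ≤ ((K : ℝ) + 1) ^ (k + 1) := by positivity
  have hX : 0 ≤ (1 - ((1 - Real.exp (-(1 / (b * k)))) / 2) ^ k) ^ m :=
    pow_nonneg (cas_base_nonneg _ k hEb0 hEb1) m
  have hY : (0 : ℝ) ≤ ((n : ℝ) + 1) ^ (2 ^ k) * Real.exp (n * β) := by positivity
  nlinarith [mul_nonneg (mul_nonneg hP hY) hX]

end Summit.PneNP.PneNP.Theorems
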